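import Mathlib
import Literature.Barriers.ValiantsHypothesis.NotViaSaturationsChowProofs
import Literature.Computability.AlgebraicComplexity.OrbitClosureWeights
import Literature.NumberTheory.DiophantineGeometry.TensorWordModel
import Summits.ValiantsHypothesis.ValiantsHypothesis.Theorems.ValuativeGCTValuativeFlipBinarySeminvariants

/-!
# Explicit two-row highest-weight vectors, I: the protomorph highest-weight vectors of `ℂ[Sym^m ℂ²]`
# (crux `ValuativeGCT.ValuativeFlip`, stmt-ValiantsHypothesis-12624; wall-breaker axis k13
# "explicit padded-permanent highest-weight vectors for seedRichness", part C)

The coordinate ring `ℂ[Sym^m ℂ²] = MvPolynomial (DegIdx (Fin 2) m) ℂ` of binary forms of degree `m`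
carries the universal binary form `𝔥 = ∑_{|d| = m} X_d x^d` (`ubin m`).  Reading the `GL₂`-action
`coordRep` on `𝔥` (`map_coordSubst_ubin`: `b` acts on the coefficients of `𝔥` as the substitution of
`𝔥` by the constant matrix `b⁻¹`), the semi-invariance of the protomorph coefficients
(`bcoeff_proto_aeval_upperSubst`, part B) becomes: the polynomials
`P_j = bcoeff m j (proto m 𝔥) ∈ ℂ[Sym^m ℂ²]` (`protoHWV m j`, degree `j + 1` in the `X_d`) are
HIGHEST-WEIGHT VECTORS for the upper triangular Borel of `GL₂`, of weight
`protoWeight m j = (-j, -(m + j(m-1)))` — the dual of the two-row partition `((j+1)m - j, j)`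
(`protoHWV_mem_highestWeightSpace`).  Their values at a binary form `g` of degree `m` are the
protomorphs of `g` (`aeval_formCoeff_protoHWV`).  Part D inherits them to the last two letters of
`ℂ[Sym^m ℂ^{m×m}]` and evaluates them on the padded permanent.

Sources: classical (Cayley–Sylvester protomorphs; Elliott, *Algebra of Quantics* §§127–131); BLMW,
SIAM J. Comput. 40 (2011) (5.2.2) for the dual-weight convention of coordinate rings; folklore.
-/

set_option linter.dupNamespace false

namespace Summit.ValiantsHypothesis.ValiantsHypothesis.Theorems.ValuativeFlip

open MvPolynomial
open scoped BigOperators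

noncomputable section

/-! ## Part C — the universal binary form, protomorph highest-weight vectors of `ℂ[Sym^m ℂ²]`, and
their inheritance to the last two letters of `ℂ[Sym^m ℂ^{m×m}]` -/

section Universal

open Literature.NumberTheory.DiophantineGeometry Literature.Computability.AlgebraicComplexity
  Literature.Barriers.ValiantsHypothesis

variable (m : ℕ)

/-- The coordinate ring `ℂ[Sym^m ℂ²]` of binary forms of degree `m` (coordinates `X_d`, `|d| = m`).
[folklore] -/
abbrev BinCoordRing : Type := MvPolynomial (DegIdx (Fin 2) m) ℂ

/-- **The universal binary form** `𝔥 = ∑_{|d| = m} X_d · x^d` of degree `m`, with coefficients in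
the coordinate ring `ℂ[Sym^m ℂ²]`. [folklore] -/
def ubin : MvPolynomial (Fin 2) (BinCoordRing m) :=
  ∑ d : DegIdx (Fin 2) m, C (X d) * monomial d.1 1

/-- The universal binary form is homogeneous of degree `m`. [folklore] -/
theorem isHomogeneous_ubin : (ubin m).IsHomogeneous m := by
  rw [ubin]
  refine IsHomogeneous.sum _ _ _ fun d _ => ?_
  have h := (isHomogeneous_C (Fin 2) (X d : BinCoordRing m)).mul
    (isHomogeneous_monomial (R := BinCoordRing m) (1 : BinCoordRing m) (mem_degMonomials_iff.mp d.2))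
  rwa [zero_add] at h

variable {m}

/-- Base change of the universal form along a ring homomorphism. [folklore] -/
theorem map_ubin {S : Type*} [CommSemiring S] (ψ : BinCoordRing m →+* S) :
    map ψ (ubin m) = ∑ d : DegIdx (Fin 2) m, C (ψ (X d)) * monomial d.1 1 := by
  rw [ubin, map_sum]
  refine Finset.sum_congr rfl fun d _ => ?_
  rw [map_mul, map_C, map_monomial, map_one]

/-- **Specialising the universal form at a binary form `g` of degree `m` returns `g`**: under
`X_d ↦ coeff_d g` the universal form maps to `g`. [folklore] -/
theorem map_aeval_formCoeff_ubin {g : MvPolynomial (Fin 2) ℂ} (hg : g.IsHomogeneous m) :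
    map (aeval (formCoeff m g) : BinCoordRing m →ₐ[ℂ] ℂ).toRingHom (ubin m) = g := by
  rw [map_ubin]
  conv_rhs => rw [← sum_coeff_smul_monomial_eq hg]
  refine Finset.sum_congr rfl fun d _ => ?_
  rw [AlgHom.toRingHom_eq_coe, RingHom.coe_coe, aeval_X, formCoeff_apply, smul_eq_C_mul]

/-- Naturality of `linSubst` under base change. [folklore] -/
theorem map_linSubst {S T : Type*} [CommRing S] [CommRing T] (f : S →+* T) (A : Matrix (Fin 2) (Fin 2) S)
    (p : MvPolynomial (Fin 2) S) :
    map f (linSubst (Fin 2) S A p) = linSubst (Fin 2) T (A.map f) (map f p) := by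
  induction p using MvPolynomial.induction_on with
  | C a => rw [linSubst_C, map_C, linSubst_C]
  | add p q hp hq => rw [map_add, map_add, map_add, hp, hq, map_add]
  | mul_X p i hp =>
    rw [map_mul, map_mul, map_mul, hp, map_X, map_mul, linSubst_X, linSubst_X, map_sum]
    congr 1
    refine Finset.sum_congr rfl fun j _ => ?_
    rw [smul_eq_C_mul, smul_eq_C_mul, map_mul, map_C, map_X, Matrix.map_apply]

/-- **The `GL₂`-action on the coordinate ring, read on the universal form**: applying
`b · (-) = coordSubst m b` to the coefficients of `𝔥` is the linear substitution of `𝔥` by the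
constant matrix `b⁻¹` (`∑_d (b · X_d) x^d = ∑_e X_e (b⁻¹ · x^e)`). [folklore] -/
theorem map_coordSubst_ubin (b : GL (Fin 2) ℂ) :
    map (coordSubst m b).toRingHom (ubin m) =
      linSubst (Fin 2) (BinCoordRing m)
        (((b⁻¹ : GL (Fin 2) ℂ) : Matrix (Fin 2) (Fin 2) ℂ).map C) (ubin m) := by
  classical
  -- right-hand side, coordinate by coordinate
  have hR : linSubst (Fin 2) (BinCoordRing m) (((b⁻¹ : GL (Fin 2) ℂ) : Matrix (Fin 2) (Fin 2) ℂ).map C)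
      (ubin m) = ∑ e : DegIdx (Fin 2) m, C (X e) * ∑ d : DegIdx (Fin 2) m,
        C (C (coeff d.1 (linSubstRep (Fin 2) ℂ b⁻¹ (monomial e.1 1)))) * monomial d.1 1 := by
    rw [ubin, map_sum]
    refine Finset.sum_congr rfl fun e _ => ?_
    rw [map_mul, ← algebraMap_eq (R := BinCoordRing m), AlgHom.commutes, algebraMap_eq]
    congr 1
    have hmon : (monomial e.1 (1 : BinCoordRing m) : MvPolynomial (Fin 2) (BinCoordRing m)) =
        map (C : ℂ →+* BinCoordRing m) (monomial e.1 (1 : ℂ)) := by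
      rw [map_monomial, C_1]
    rw [hmon, ← map_linSubst, linSubstRep_apply]
    conv_lhs => rw [← sum_coeff_smul_monomial_eq (linSubst_isHomogeneous _
      (isHomogeneous_monomial (R := ℂ) (1 : ℂ) (mem_degMonomials_iff.mp e.2)))]
    rw [map_sum]
    refine Finset.sum_congr rfl fun d _ => ?_
    rw [smul_eq_C_mul, map_mul, map_C, map_monomial, C_1]
  -- left-hand side
  rw [hR, map_ubin]
  simp only [AlgHom.toRingHom_eq_coe, RingHom.coe_coe, coordSubst_X, map_sum, Finset.sum_mul,
    Finset.mul_sum]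
  rw [Finset.sum_comm]
  refine Finset.sum_congr rfl fun e _ => Finset.sum_congr rfl fun d _ => ?_
  rw [smul_eq_C_mul, map_mul]
  ring

/-- An upper triangular constant matrix acts on binary forms over any base by `upperSubst`.
[folklore] -/
theorem linSubst_map_C_eq_aeval_upperSubst {S : Type*} [CommRing S] (c : Matrix (Fin 2) (Fin 2) ℂ)
    [Algebra ℂ S] (hc : c 1 0 = 0) (p : MvPolynomial (Fin 2) S) :
    linSubst (Fin 2) S (c.map (algebraMap ℂ S)) p =
      aeval (upperSubst (algebraMap ℂ S (c 0 0)) (algebraMap ℂ S (c 0 1)) (algebraMap ℂ S (c 1 1))) p := by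
  suffices h : linSubst (Fin 2) S (c.map (algebraMap ℂ S)) =
      aeval (upperSubst (algebraMap ℂ S (c 0 0)) (algebraMap ℂ S (c 0 1)) (algebraMap ℂ S (c 1 1))) from
    congrArg (fun φ => φ p) h
  refine MvPolynomial.algHom_ext fun i => ?_
  rw [linSubst_X, aeval_X, Fin.sum_univ_two]
  fin_cases i
  · simp only [Fin.zero_eta, Fin.isValue, Matrix.map_apply, hc, map_zero, zero_smul, add_zero,
      smul_eq_C_mul, upperSubst_zero]
  · simp only [Fin.mk_one, Fin.isValue, Matrix.map_apply, smul_eq_C_mul, upperSubst_one]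

/-- Naturality of the protomorph normalisation under base change. [folklore] -/
theorem map_proto {S T : Type*} [CommRing S] [CommRing T] (f : S →+* T) (m : ℕ)
    (g : MvPolynomial (Fin 2) S) : map f (proto m g) = proto m (map f g) := by
  rw [proto, proto, aeval_def, algebraMap_eq, map_eval₂, aeval_def, algebraMap_eq]
  congr 1
  funext i
  fin_cases i
  · simp [Function.comp_apply, bcoeff, coeff_map, map_natCast]
  · simp [Function.comp_apply, bcoeff, coeff_map]

variable (m)

/-- **The protomorph highest-weight vectors of `ℂ[Sym^m ℂ²]`**: `P_j = bcoeff m j (proto m 𝔥)`, the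
`j`-th coefficient of the normalised universal form — a polynomial of degree `j + 1` in the
coordinates `X_d`. [folklore] -/
def protoHWV (j : ℕ) : BinCoordRing m :=
  bcoeff m j (proto m (ubin m))

/-- The weight of `P_j`: `(-j, -(m + j(m-1)))` on the letters `(s, t) = (0, 1)`, i.e. the dual
`λ^*` of the two-row partition `λ = ((j+1)m - j, j) ⊢ (j+1)m`. [folklore] -/
def protoWeight (j : ℕ) : Weight (Fin 2) :=
  fun i => if i = 0 then -(j : ℤ) else -((m + j * (m - 1) : ℕ) : ℤ)

variable {m}

/-- **Specialisation**: the value of `P_j` at (the coefficient vector of) a binary form `g` of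
degree `m` is the `j`-th protomorph of `g`. [folklore] -/
theorem aeval_formCoeff_protoHWV {g : MvPolynomial (Fin 2) ℂ} (hg : g.IsHomogeneous m) (j : ℕ) :
    aeval (formCoeff m g) (protoHWV m j) = bcoeff m j (proto m g) := by
  have h := congrArg (coeff (bexp m j))
    (map_proto (aeval (formCoeff m g) : BinCoordRing m →ₐ[ℂ] ℂ).toRingHom m (ubin m))
  rw [coeff_map, map_aeval_formCoeff_ubin hg] at h
  exact h

/-- **`P_j` is a highest-weight vector of `ℂ[Sym^m ℂ²]` of weight `protoWeight m j`** (`1 ≤ m`,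
`j ≤ m`): an upper triangular `b` acts on the coefficients of `𝔥` as the substitution of `𝔥` by
`b⁻¹ = (α, β; 0, γ)` (`map_coordSubst_ubin`), which the protomorph normalisation absorbs up to the
scalar `γ^m (α γ^{m-1})^j = b₀₀^{-j} b₁₁^{-(m + j(m-1))}` (`bcoeff_proto_aeval_upperSubst`).
[folklore] -/
theorem protoHWV_mem_highestWeightSpace {m : ℕ} (hm : 1 ≤ m) {j : ℕ} (hj : j ≤ m) :
    protoHWV m j ∈ highestWeightSpace (coordRep (Fin 2) ℂ m) (protoWeight m j) := by
  intro b hb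
  have hb' : IsUpperTriangular b⁻¹ := (borelSubgroup (Fin 2) ℂ).inv_mem hb
  set c : Matrix (Fin 2) (Fin 2) ℂ := ((b⁻¹ : GL (Fin 2) ℂ) : Matrix (Fin 2) (Fin 2) ℂ) with hc
  have hc10 : c 1 0 = 0 := hb'.apply_eq_zero (by decide)
  have hc00 : c 0 0 = ((b : Matrix (Fin 2) (Fin 2) ℂ) 0 0)⁻¹ := inv_apply_diag_of_isUpperTriangular' hb 0
  have hc11 : c 1 1 = ((b : Matrix (Fin 2) (Fin 2) ℂ) 1 1)⁻¹ := inv_apply_diag_of_isUpperTriangular' hb 1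
  -- transport the action to the universal form
  have key : coordSubst m b (protoHWV m j) =
      bcoeff m j (proto m (map (coordSubst m b).toRingHom (ubin m))) := by
    rw [protoHWV, bcoeff, bcoeff, ← map_proto, coeff_map, AlgHom.toRingHom_eq_coe, RingHom.coe_coe]
  rw [coordRep_apply, key, map_coordSubst_ubin, ← hc, ← algebraMap_eq (R := ℂ),
    linSubst_map_C_eq_aeval_upperSubst c hc10, bcoeff_proto_aeval_upperSubst hm (isHomogeneous_ubin m)
    _ _ _ hj, ← protoHWV, algebraMap_eq, smul_eq_C_mul, ← map_pow, ← map_pow, ← map_mul, ← map_pow,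
    ← map_mul]
  congr 1
  -- the scalar is the weight character
  have hw0 : protoWeight m j 0 = -(j : ℤ) := if_pos rfl
  have hw1 : protoWeight m j 1 = -((m + j * (m - 1) : ℕ) : ℤ) := if_neg (by decide)
  rw [weightChar, Fin.prod_univ_two, hw0, hw1, zpow_neg, zpow_neg, zpow_natCast, zpow_natCast,
    ← inv_pow, ← inv_pow, hc00, hc11]
  ring

end Universal

end

end Summit.ValiantsHypothesis.ValiantsHypothesis.Theorems.ValuativeFlip
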